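import Summits.Ventures.CertifiedQuantumChemistry.Rows.SOSDualSlices
import HarnessLib

/-!
# Ventures/CertifiedQuantumChemistry — Rows/SOSDualMerge.lean: ENCODED LINEAR-MERGE accumulation for the block-wise
# kernel replay of SDP dual certificates (`Rows/SOSDualReplay.lean`, `Rows/SOSDualSlices.lean`) + MULTIPLIER SLICES

HONEST FRAMING (verbatim): certified bounds for a stated model Hamiltonian in a stated basis; not a claim about
the real molecule beyond that model.

var-2 (gen 20), zero compute; computable definitions + their soundness lemmas (no claim node, no model, NO BOUND
ASSERTED). WHY: a chain step of `Rows/SOSDualReplay.lean` is `collect (decPoly k C ++ normalize T)`: it DECODES and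
RE-SORTS the whole accumulated polynomial `C` together with the new normal-ordered terms and then compares DECODED
polynomials (`decPoly k C' = …`, letters `Orb (Fin k)`, coefficients `ℚ`). Measured on the farm by var-2 g20 (session
NOTES; `--memory=12288` on every node): at `k = 8` (Hubbard ring `L = 8`, 16 spin-orbitals) the accumulated polynomial
has 5 793 monomials once the `αβ` blocks are in, and ONE 2 048-pair Gram slice step on top of it needs ≈ 5.0 GB of kernel
heap (≈ 3.7 GB with a decoded linear merge) — at or beyond the budget of a build-lane process whose import baseline is
≈ 7 GB. The `k = 6` design therefore does not reach `k = 8`.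

Here the accumulation runs ENTIRELY ON THE ENCODED SIDE (`EncPoly` of `Rows/SOSDualCert.lean`: monomials as code
lists `List ℕ × List ℕ`, coefficients as `(numerator, denominator)`):

* `mergeE B C N` — ONE linear `CARPoly.mergeByKey` pass (keys `keyE`, plain `ℕ` comparisons) over the key-tagged
  encoded term lists, then `mergeAdjE`: equal ADJACENT code lists are merged (rational arithmetic ONLY on a
  coincidence; pass-through terms are copied untouched) and zero numerators dropped (`emitE`);
* soundness `evalPoly_decPoly_mergeE`: `decPoly k (mergeE B C N)` denotes the sum of what `decPoly k C` and
  `decPoly k N` denote — a permutation + merging of equal adjacent monomials + dropping zeros, exactly the argument of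
  `CARPoly.evalPoly_collect`; no property of the key or of sortedness is used (sortedness of both inputs only makes the
  output the fully collected normal form, i.e. the tightest `ℓ¹`, which the kernel never has to know);
* `decPoly_encPoly`: decoding inverts encoding (`decOrb k (encL x) = x`, `q.num / q.den = q`), so a step may take the
  new terms as `encPoly (normalize encL B T)`;
* `evalPoly_mergeStepE` / `evalPoly_mergeFinalE` — the analogues of `evalPoly_chainStep` / `evalPoly_final`;
* `multTermsL` / `termOp_negTerms_multTerms_slices` — the MULTIPLIER part of a certificate as a sum over consecutive
  slices of the multiplier list (`slicesFrom` of `Rows/SOSDualSlices.lean`), so that the multiplier step, too, can be cut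
  into several kernel declarations (at `k = 8` the one-piece multiplier step of 146 multipliers needs ≈ 3.9 GB).

An instance chain then reads `C_i := eval% mergeE B C_{i-1} (encPoly (normalize encL B T_i))`,
`C_i_ok : C_i = mergeE B C_{i-1} (encPoly (normalize encL B T_i)) := by decide +kernel` (an equation of ENCODED
polynomials: lists of naturals and integers), and the assembling proof rewrites with `C_i_ok, evalPoly_mergeStepE`
where the `k = 6` files rewrite with `C_i_ok, evalPoly_chainStep`. Per step the kernel normal-orders only the new
slice and never decodes, re-sorts or rationally re-normalises the accumulated polynomial.
-/

namespace Summit.Ventures.CertifiedQuantumChemistry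

open Matrix
open Literature.MathematicalPhysics.QuantumLattice Literature.MathematicalPhysics.QuantumChemistry
open CARPoly

namespace SOSDual

/-! ## Encoded merge (computable) -/

section Computable

/-- An encoded monomial: (creator codes, annihilator codes), codes `2·p + σ`. -/
abbrev EMono := List ℕ × List ℕ

/-- The rational an encoded coefficient `(numerator, denominator)` denotes (the reading of `decPoly`). -/
def qOf (c : ℤ × ℕ) : ℚ := (c.1 : ℚ) / c.2

/-- Sort key of an encoded monomial: the packing of `CARPoly.Mono.key` applied to the codes themselves. -/
def keyE (B : ℕ) (m : EMono) : ℕ := CARPoly.Mono.key id B m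

/-- Sum of two encoded coefficients, re-encoded as (numerator, denominator) of the normalised rational. -/
def addE (c d : ℤ × ℕ) : ℤ × ℕ := ((qforce (qOf c + qOf d)).num, (qforce (qOf c + qOf d)).den)

/-- Emit an encoded term unless its numerator is zero. -/
def emitE (m : EMono) (c : ℤ × ℕ) (rest : EncPoly) : EncPoly := if c.1 = 0 then rest else (m, c) :: rest

/-- Merge runs of equal ADJACENT encoded monomials (structural equality of the code lists), adding coefficients
(`addE`, only on a coincidence) and dropping zero numerators; pass-through terms are copied untouched. -/
def mergeAdjE : EMono → ℤ × ℕ → EncPoly → EncPoly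
  | m, c, [] => emitE m c []
  | m, c, mc :: rest => if m = mc.1 then mergeAdjE m (addE c mc.2) rest else emitE m c (mergeAdjE mc.1 mc.2 rest)

/-- **Encoded linear merge**: key-merge two encoded polynomials and merge equal adjacent monomials. -/
def mergeE (B : ℕ) (C N : EncPoly) : EncPoly :=
  match (mergeByKey (C.map fun mc => (keyE B mc.1, mc)) (N.map fun mc => (keyE B mc.1, mc))).map Prod.snd with
  | [] => []
  | mc :: rest => mergeAdjE mc.1 mc.2 rest

end Computable

/-! ## Soundness -/

section Sound

variable {k : ℕ} [NeZero k]

/-- Decoding one encoded monomial. -/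
def decM (k : ℕ) [NeZero k] (m : EMono) : CARPoly.Mono (Orb (Fin k)) := (m.1.map (decOrb k), m.2.map (decOrb k))

omit [NeZero k] in
/-- `qOf` of a sum re-encoding is the sum. -/
theorem qOf_addE (c d : ℤ × ℕ) : qOf (addE c d) = qOf c + qOf d := by
  unfold addE
  rw [qforce_eq]
  exact Rat.num_div_den _

/-- `decPoly` is a `map`: it decodes term by term. -/
theorem decPoly_eq_map (E : EncPoly) : decPoly k E = E.map fun mc => (decM k mc.1, qOf mc.2) := rfl

/-- `decPoly` of a cons. -/
theorem decPoly_cons (mc : EMono × (ℤ × ℕ)) (E : EncPoly) :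
    decPoly k (mc :: E) = (decM k mc.1, qOf mc.2) :: decPoly k E := rfl

/-- `decPoly` of a concatenation. -/
theorem decPoly_append (E F : EncPoly) : decPoly k (E ++ F) = decPoly k E ++ decPoly k F := by
  rw [decPoly_eq_map, List.map_append, ← decPoly_eq_map, ← decPoly_eq_map]

/-- `emitE` is sound: a dropped term has coefficient zero. -/
theorem evalPoly_decPoly_emitE (m : EMono) (c : ℤ × ℕ) (rest : EncPoly) :
    evalPoly id (decPoly k (emitE m c rest)) = ((qOf c : ℚ) : ℂ) • evalMono id (decM k m) + evalPoly id (decPoly k rest) := by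
  unfold emitE
  split_ifs with h
  · have : qOf c = 0 := by simp [qOf, h]
    rw [this, Rat.cast_zero, zero_smul, zero_add]
  · rw [decPoly_cons, evalPoly_cons]

/-- `mergeAdjE` is sound. -/
theorem evalPoly_decPoly_mergeAdjE : ∀ (m : EMono) (c : ℤ × ℕ) (E : EncPoly),
    evalPoly id (decPoly k (mergeAdjE m c E)) = ((qOf c : ℚ) : ℂ) • evalMono id (decM k m) + evalPoly id (decPoly k E)
  | m, c, [] => by rw [mergeAdjE, evalPoly_decPoly_emitE]
  | m, c, mc :: rest => by
    rw [mergeAdjE]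
    split_ifs with h
    · rw [evalPoly_decPoly_mergeAdjE m (addE c mc.2) rest, qOf_addE, decPoly_cons, evalPoly_cons, h, Rat.cast_add,
        add_smul, add_assoc]
    · rw [evalPoly_decPoly_emitE, evalPoly_decPoly_mergeAdjE mc.1 mc.2 rest, decPoly_cons, evalPoly_cons]

omit [NeZero k] in
/-- The key-merge, untagged, is a permutation of the concatenation. -/
theorem map_snd_mergeByKey_perm (B : ℕ) (C N : EncPoly) :
    ((mergeByKey (C.map fun mc => (keyE B mc.1, mc)) (N.map fun mc => (keyE B mc.1, mc))).map Prod.snd).Perm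
      (C ++ N) := by
  have h := (mergeByKey_perm (C.map fun mc => (keyE B mc.1, mc)) (N.map fun mc => (keyE B mc.1, mc))).map Prod.snd
  rw [List.map_append, List.map_map, List.map_map] at h
  have hid : (Prod.snd ∘ fun mc : EMono × (ℤ × ℕ) => (keyE B mc.1, mc)) = id := rfl
  rw [hid, List.map_id, List.map_id] at h
  exact h

/-- **Soundness of `mergeE`**: the merge denotes the sum (a permutation + merging adjacent equal monomials + dropping
zeros do not change the operator; no property of the key or of sortedness is used). -/
theorem evalPoly_decPoly_mergeE (B : ℕ) (C N : EncPoly) :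
    evalPoly id (decPoly k (mergeE B C N)) = evalPoly id (decPoly k C) + evalPoly id (decPoly k N) := by
  have hperm : (decPoly k ((mergeByKey (C.map fun mc => (keyE B mc.1, mc)) (N.map fun mc => (keyE B mc.1, mc))).map
      Prod.snd)).Perm (decPoly k (C ++ N)) := by
    rw [decPoly_eq_map, decPoly_eq_map]
    exact (map_snd_mergeByKey_perm B C N).map _
  rw [← evalPoly_append, ← decPoly_append, ← evalPoly_perm id hperm]
  unfold mergeE
  cases hL : (mergeByKey (C.map fun mc => (keyE B mc.1, mc)) (N.map fun mc => (keyE B mc.1, mc))).map Prod.snd with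
  | nil => rfl
  | cons mc rest => rw [evalPoly_decPoly_mergeAdjE, decPoly_cons, evalPoly_cons]

/-- Decoding a letter code recovers the letter. -/
theorem decOrb_encL (x : Orb (Fin k)) : decOrb k (encL x) = x := by
  have hp : (ofLex x).1.val < k := (ofLex x).1.isLt
  have hs : (ofLex x).2.val < 2 := (ofLex x).2.isLt
  have h1 : (2 * (ofLex x).1.val + (ofLex x).2.val) / 2 = (ofLex x).1.val := by omega
  have h2 : (2 * (ofLex x).1.val + (ofLex x).2.val) % 2 = (ofLex x).2.val := by omega
  unfold decOrb encL
  rw [h1, h2]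
  have e1 : Fin.ofNat k (ofLex x).1.val = (ofLex x).1 := Fin.ext (Nat.mod_eq_of_lt hp)
  have e2 : (if (ofLex x).2.val = 0 then (0 : Fin 2) else 1) = (ofLex x).2 := by
    ext; split_ifs with h <;> simp <;> omega
  rw [e1, e2]
  rfl

/-- Decoding a coded letter list recovers the list. -/
theorem map_decOrb_encL (l : List (Orb (Fin k))) : (l.map encL).map (decOrb k) = l := by
  rw [List.map_map]
  conv_rhs => rw [← List.map_id l]
  exact List.map_congr_left fun x _ => decOrb_encL x

/-- **Decoding inverts encoding.** -/
theorem decPoly_encPoly (P : CARPoly.Poly (Orb (Fin k))) : decPoly k (encPoly P) = P := by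
  rw [decPoly_eq_map, encPoly, List.map_map]
  conv_rhs => rw [← List.map_id P]
  refine List.map_congr_left fun mq _ => ?_
  simp only [Function.comp_apply, decM, qOf, id]
  rw [map_decOrb_encL, map_decOrb_encL, Rat.num_div_den]

/-- Semantics of one ENCODED LINEAR-MERGE accumulation step `mergeE B C (encPoly (normalize encL B T))`. -/
theorem evalPoly_mergeStepE (B : ℕ) (C : EncPoly) (T : Terms k) :
    evalPoly id (decPoly k (mergeE B C (encPoly (CARPoly.normalize encL B T)))) =
      evalPoly id (decPoly k C) + termOp T := by
  rw [evalPoly_decPoly_mergeE, decPoly_encPoly, evalPoly_normalize_id]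

/-- Semantics of the ENCODED final assembly `mergeE B (encPoly (collect encL B (termsToPoly (hamTerms F)))) C`. -/
theorem evalPoly_mergeFinalE (F : Model k) (B : ℕ) (C : EncPoly) :
    evalPoly id (decPoly k (mergeE B (encPoly (collect encL B (termsToPoly (hamTerms F)))) C)) =
      termOp (hamTerms F) + evalPoly id (decPoly k C) := by
  rw [evalPoly_decPoly_mergeE, decPoly_encPoly, evalPoly_collect, evalPoly_termsToPoly_id]

end Sound

/-! ## Multiplier slices -/

section MultSlices

variable {k : ℕ} [NeZero k]

/-- Multiplier terms of a LIST of multipliers (`multTerms k a b c` is the case `c.mults`). -/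
def multTermsL (k : ℕ) [NeZero k] (a b : ℕ) (ms : List Mult) : Terms k :=
  ms.flatMap fun M => multTermsOf M.coeff (decWord k M.word) M.tau (if M.spin = 0 then a else b)

/-- `multTerms` is `multTermsL` of the certificate's multiplier list. -/
theorem multTerms_eq_multTermsL (a b : ℕ) (c : Cert) : multTerms k a b c = multTermsL k a b c.mults := rfl

/-- `multTermsL` is additive in the multiplier list. -/
theorem multTermsL_append (a b : ℕ) (m₁ m₂ : List Mult) :
    multTermsL k a b (m₁ ++ m₂) = multTermsL k a b m₁ ++ multTermsL k a b m₂ := by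
  simp [multTermsL, List.flatMap_append]

/-- The (negated) multiplier operator of a flattened family of multiplier lists is the sum over the family. -/
theorem termOp_negTerms_multTermsL_flatten (a b : ℕ) : ∀ L : List (List Mult),
    termOp (negTerms (multTermsL k a b L.flatten)) = (L.map fun ms => termOp (negTerms (multTermsL k a b ms))).sum
  | [] => by simp [multTermsL]
  | ms :: L => by
    rw [List.flatten_cons, multTermsL_append, negTerms_append, termOp_append, List.map_cons, List.sum_cons,
      termOp_negTerms_multTermsL_flatten a b L]

/-- **Slicing the multiplier part**: `−Mult(c) = Σ_slices −Mult(slice)` over the consecutive slices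
`slicesFrom c.mults ns` — for ANY slice sizes `ns`. -/
theorem termOp_negTerms_multTerms_slices (a b : ℕ) (c : Cert) (ns : List ℕ) :
    termOp (negTerms (multTerms k a b c)) =
      ((slicesFrom c.mults ns).map fun ms => termOp (negTerms (multTermsL k a b ms))).sum := by
  have h := termOp_negTerms_multTermsL_flatten (k := k) a b (slicesFrom c.mults ns)
  rw [flatten_slicesFrom] at h
  rw [multTerms_eq_multTermsL]
  exact h

end MultSlices

end SOSDual

end Summit.Ventures.CertifiedQuantumChemistry
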